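import Literature.Analysis.FluidPDE.AncientMildRepresentative
import HarnessLib

/-!
# Weak-* continuity modulo constants in the duality-form class of bounded ancient mild solutions

Analysis/FluidPDE support file (all results proved; no definitions, no named facts), continuing
`AncientMildWeakStar` / `AncientMildRepresentative` (Koch–Nadirashvili–Seregin–Šverák 2009, §1 p. 3:
the parasitic drift `b(t)` of bounded weak solutions). Those files pin the spatially constant gauge
by a decay hypothesis (`r‖u‖ ≤ C`); this file removes the gauge instead, by subtracting the average
of each slice against a fixed bump, and shows that NOTHING ELSE obstructs weak-* continuity in time
and joint measurability in the slice-wise duality-form class `IsBoundedAncientMildSolution`. It is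
the first step of the bridge "duality-form bounded ancient mild solutions are Galilean images of
KNSS-mild (Oseen-integral) ones" needed to transport printed Liouville theorems (KNSS 2009 Thms
5.1–5.3, Albritton–Barker 2019 Thm 1.2) to the tree's rendering `LiouvilleConjectureNS` of the
Liouville conjecture (L) (crux `TypeIliouvilleL`, item stmt-NavierStokesRegularity-10661).

Main results (any finite-dimensional real inner product space `E`):

* `lintegral_enorm_sub_translate_le` — **`L¹` modulus of continuity under translation**:
  `∫ ‖g(x − y) − g(x)‖ ≤ ‖y‖ ∫ ‖Dg‖` for `g ∈ C¹`.
* `exists_integral_norm_heatExtension_le_of_integral_eq_zero` — **caloric `L¹` decay of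
  mean-zero data**: for `θ` continuous, compactly supported with `∫ θ = 0`,
  `∫ ‖e^{σΔ}θ‖ ≤ K σ^{-1/2}` (`e^{σΔ}θ = ∫ (G_σ(· − y) − G_σ) θ(y) dy` and the `L¹` gradient bound
  `‖∇G_σ‖₁ ≤ 2^{n/2} σ^{-1/2}` of the heat kernel).
* `continuousOn_integral_inner_of_integral_eq_zero` — for a bounded family `u(t)`, `t < 0`, with
  measurable, weakly divergence-free slices whose pairings with divergence-free test fields are
  continuous in time (e.g. a bounded ancient mild solution in duality form,
  `IsBoundedAncientMildSolution.continuousOn_integral_inner`), the pairing `t ↦ ∫⟪u(t), θ⟫` with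
  ANY mean-zero test field `θ` is continuous (`θ` has caloric decay, so it is `−ΔW` up to an
  `L¹`-small error, `exists_test_integral_norm_laplacian_add_le`, and pairings with `ΔW` are
  continuous, `continuousOn_integral_inner_laplacian_of_divFree`).
* `continuousOn_integral_inner_sub_average` — hence the **normalised family**
  `u(t) − m(t)`, `m(t) = ∫ ρ u(t)` the average against a fixed bump `ρ` of mass one, is **weak-*
  continuous in time**: `t ↦ ∫⟪u(t) − m(t), θ⟫` is continuous for every test field `θ`.
* `IsBoundedAncientMildSolution.exists_stronglyMeasurable_modification_sub_average` — a bounded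
  ancient mild solution in duality form with measurable slices is, slice-wise a.e. and **modulo
  the spatial constants `m(t)`**, a jointly strongly measurable field (KNSS 2009, §1 p.3: the
  parasitic drift `b(t)` is the only obstruction; `AncientMildRepresentative.exists_stronglyMeasurable_modification`).

## References

* G. Koch, N. Nadirashvili, G. Seregin, V. Šverák, *Liouville theorems for the Navier–Stokes
  equations and applications*, Acta Math. 203 (2009) 83–105 = arXiv:0709.3599, §1 p. 3 (the
  parasitic solutions `u(x,t) = b(t)`), §4 (i)–(ii) p. 8. [KochNadirashviliSereginSverak2009]
* Y. Giga, M.-H. Giga, J. Saal, *Nonlinear Partial Differential Equations* (Birkhäuser 2010),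
  §1.1.3 (`‖∇G_t‖₁ ∝ t^{-1/2}`). [GigaGigaSaal2010]
-/

noncomputable section

open MeasureTheory Set Function Filter Topology TopologicalSpace InnerProductSpace
open scoped RealInnerProductSpace NNReal ENNReal ContDiff Laplacian

namespace Literature.Analysis.FluidPDE

open Literature.Analysis.UnboundedOperators

variable {E : Type*} [NormedAddCommGroup E] [InnerProductSpace ℝ E] [FiniteDimensional ℝ E]
  [MeasurableSpace E] [BorelSpace E]
variable {F : Type*} [NormedAddCommGroup F] [NormedSpace ℝ F]

/-! ### `L¹` modulus of continuity under translation -/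

section Translate

omit [FiniteDimensional ℝ E] [MeasurableSpace E] [BorelSpace E] in
/-- Pointwise form of the fundamental theorem of calculus along the segment from `x` to `x − y`:
`‖g(x − y) − g(x)‖ ≤ ∫₀¹ ‖Dg(x − s y)‖ ‖y‖ ds` for `g ∈ C¹`. [folklore] -/
theorem enorm_sub_translate_le [CompleteSpace F] {g : E → F} (hg : ContDiff ℝ 1 g) (x y : E) :
    ‖g (x - y) - g x‖ₑ ≤ ∫⁻ s in Ioc (0 : ℝ) 1, ‖fderiv ℝ g (x - s • y)‖ₑ * ‖y‖ₑ := by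
  have hγ : ∀ s : ℝ, HasDerivAt (fun s : ℝ => x - s • y) (-y) s := fun s => by
    simpa using ((hasDerivAt_id s).smul_const y).const_sub x
  have hd : ∀ s : ℝ, HasDerivAt (fun s : ℝ => g (x - s • y)) (fderiv ℝ g (x - s • y) (-y)) s :=
    fun s => ((hg.differentiable one_ne_zero) _).hasFDerivAt.comp_hasDerivAt s (hγ s)
  have hcont : Continuous fun s : ℝ => fderiv ℝ g (x - s • y) (-y) :=
    ((hg.continuous_fderiv one_ne_zero).comp (by fun_prop)).clm_apply continuous_const
  have hftc : ∫ s in (0 : ℝ)..1, fderiv ℝ g (x - s • y) (-y) =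
      g (x - (1 : ℝ) • y) - g (x - (0 : ℝ) • y) :=
    intervalIntegral.integral_eq_sub_of_hasDerivAt (fun s _ => hd s) (hcont.intervalIntegrable _ _)
  simp only [one_smul, zero_smul, sub_zero] at hftc
  rw [← hftc, intervalIntegral.integral_of_le zero_le_one]
  refine (enorm_integral_le_lintegral_enorm _).trans (lintegral_mono fun s => ?_)
  calc ‖fderiv ℝ g (x - s • y) (-y)‖ₑ ≤ ‖fderiv ℝ g (x - s • y)‖ₑ * ‖-y‖ₑ :=
        (fderiv ℝ g (x - s • y)).le_opENorm (-y)
    _ = ‖fderiv ℝ g (x - s • y)‖ₑ * ‖y‖ₑ := by rw [enorm_neg]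

/-- **`L¹` modulus of continuity under translation**: `∫ ‖g(x − y) − g(x)‖ dx ≤ ‖y‖ ∫ ‖Dg‖` for
`g ∈ C¹` (Tonelli on the segment representation and translation invariance of Lebesgue measure).
[folklore] -/
theorem lintegral_enorm_sub_translate_le [CompleteSpace F] {g : E → F} (hg : ContDiff ℝ 1 g) (y : E) :
    ∫⁻ x, ‖g (x - y) - g x‖ₑ ≤ ‖y‖ₑ * ∫⁻ x, ‖fderiv ℝ g x‖ₑ := by
  have hDc : Continuous (fderiv ℝ g) := hg.continuous_fderiv one_ne_zero
  have hmeas : AEMeasurable (uncurry fun (x : E) (s : ℝ) => ‖fderiv ℝ g (x - s • y)‖ₑ * ‖y‖ₑ)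
      ((volume : Measure E).prod ((volume : Measure ℝ).restrict (Ioc 0 1))) := by
    refine Measurable.aemeasurable ?_
    exact ((hDc.comp (by fun_prop : Continuous fun p : E × ℝ => p.1 - p.2 • y)).measurable.enorm).mul
      measurable_const
  calc ∫⁻ x, ‖g (x - y) - g x‖ₑ
      ≤ ∫⁻ x, ∫⁻ s in Ioc (0 : ℝ) 1, ‖fderiv ℝ g (x - s • y)‖ₑ * ‖y‖ₑ :=
        lintegral_mono fun x => enorm_sub_translate_le hg x y
    _ = ∫⁻ s in Ioc (0 : ℝ) 1, ∫⁻ x, ‖fderiv ℝ g (x - s • y)‖ₑ * ‖y‖ₑ :=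
        lintegral_lintegral_swap hmeas
    _ = ∫⁻ _s in Ioc (0 : ℝ) 1, (∫⁻ x, ‖fderiv ℝ g x‖ₑ) * ‖y‖ₑ := by
        refine lintegral_congr fun s => ?_
        rw [lintegral_mul_const' _ _ enorm_ne_top]
        congr 1
        exact lintegral_sub_right_eq_self (fun x => ‖fderiv ℝ g x‖ₑ) (s • y)
    _ = ‖y‖ₑ * ∫⁻ x, ‖fderiv ℝ g x‖ₑ := by
        rw [setLIntegral_const, Real.volume_Ioc, sub_zero, ENNReal.ofReal_one, mul_one, mul_comm]

end Translate

/-! ### Caloric `L¹` decay of mean-zero data -/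

section Caloric

omit [FiniteDimensional ℝ E] [MeasurableSpace E] [BorelSpace E] in
/-- The heat kernel is `C¹` (indeed smooth: a Gaussian). [folklore] -/
theorem contDiff_one_heatKernel (t : ℝ) : ContDiff ℝ 1 (heatKernel (E := E) t) := by
  have h : heatKernel (E := E) t = fun x =>
      (4 * Real.pi * t) ^ (-(Module.finrank ℝ E : ℝ) / 2) * Real.exp (-(1 / (4 * t)) * ‖x‖ ^ 2) := by
    funext x
    rw [heatKernel]
    congr 1
    ring_nf
  rw [h]
  exact contDiff_const.mul ((contDiff_const.mul (contDiff_norm_sq ℝ)).exp)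

/-- **Representation of `e^{σΔ}θ` for mean-zero `θ`**:
`e^{σΔ}θ(x) = ∫ (G_σ(x − y) − G_σ(x)) • θ(y) dy`. [folklore] -/
theorem heatExtension_eq_integral_kernel_sub [CompleteSpace F] {θ : E → F} (hθc : Continuous θ)
    (hθs : HasCompactSupport θ) (hθ0 : ∫ y, θ y = 0) (σ : ℝ) (x : E) :
    heatExtension θ σ x = ∫ y, (heatKernel σ (x - y) - heatKernel σ x) • θ y := by
  have h1 : Integrable (fun y => heatKernel σ (x - y) • θ y) volume := by
    refine Continuous.integrable_of_hasCompactSupport ?_ hθs.smul_left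
    exact ((continuous_heatKernel σ).comp (continuous_const.sub continuous_id)).smul hθc
  have h2 : Integrable (fun y => heatKernel σ x • θ y) volume :=
    (hθc.integrable_of_hasCompactSupport hθs).smul _
  rw [heatExtension_eq_integral_sub]
  have h0 : ∫ y, heatKernel σ x • θ y = 0 := by
    rw [integral_smul, hθ0, smul_zero]
  calc ∫ y, heatKernel σ (x - y) • θ y
      = (∫ y, heatKernel σ (x - y) • θ y) - ∫ y, heatKernel σ x • θ y := by rw [h0, sub_zero]
    _ = ∫ y, (heatKernel σ (x - y) • θ y - heatKernel σ x • θ y) := (integral_sub h1 h2).symm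
    _ = ∫ y, (heatKernel σ (x - y) - heatKernel σ x) • θ y :=
        integral_congr_ae (Eventually.of_forall fun y => by simp only [sub_smul])

/-- **Caloric `L¹` decay of mean-zero data, `lintegral` form**:
`∫ ‖e^{σΔ}θ‖ ≤ (∫ ‖y‖ ‖θ(y)‖ dy) · ‖∇G_σ‖_{L¹}` for `θ` continuous, compactly supported, `∫ θ = 0`
(Tonelli, then the `L¹` modulus of continuity of the kernel under translation). [folklore] -/
theorem lintegral_enorm_heatExtension_le_of_integral_eq_zero [CompleteSpace F] {θ : E → F}
    (hθc : Continuous θ) (hθs : HasCompactSupport θ) (hθ0 : ∫ y, θ y = 0) (σ : ℝ) :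
    ∫⁻ x, ‖heatExtension θ σ x‖ₑ ≤
      (∫⁻ y, ‖y‖ₑ * ‖θ y‖ₑ) * ∫⁻ x, ‖fderiv ℝ (heatKernel (E := E) σ) x‖ₑ := by
  have hK : Continuous (heatKernel (E := E) σ) := continuous_heatKernel σ
  have hmeas : AEMeasurable (uncurry fun (x y : E) => ‖heatKernel σ (x - y) - heatKernel σ x‖ₑ * ‖θ y‖ₑ)
      ((volume : Measure E).prod (volume : Measure E)) := by
    refine Measurable.aemeasurable ?_
    exact (((hK.comp (by fun_prop : Continuous fun p : E × E => p.1 - p.2)).sub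
      (hK.comp continuous_fst)).measurable.enorm).mul
      ((hθc.comp continuous_snd).enorm).measurable
  calc ∫⁻ x, ‖heatExtension θ σ x‖ₑ
      = ∫⁻ x, ‖∫ y, (heatKernel σ (x - y) - heatKernel σ x) • θ y‖ₑ := by
        refine lintegral_congr fun x => ?_
        rw [heatExtension_eq_integral_kernel_sub hθc hθs hθ0]
    _ ≤ ∫⁻ x, ∫⁻ y, ‖heatKernel σ (x - y) - heatKernel σ x‖ₑ * ‖θ y‖ₑ := by
        refine lintegral_mono fun x => (enorm_integral_le_lintegral_enorm _).trans (lintegral_mono fun y => ?_)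
        rw [enorm_smul]
    _ = ∫⁻ y, ∫⁻ x, ‖heatKernel σ (x - y) - heatKernel σ x‖ₑ * ‖θ y‖ₑ := lintegral_lintegral_swap hmeas
    _ ≤ ∫⁻ y, (‖y‖ₑ * ∫⁻ x, ‖fderiv ℝ (heatKernel (E := E) σ) x‖ₑ) * ‖θ y‖ₑ := by
        refine lintegral_mono fun y => ?_
        rw [lintegral_mul_const' _ _ enorm_ne_top]
        gcongr
        have h := lintegral_enorm_sub_translate_le (F := ℝ) (contDiff_one_heatKernel (E := E) σ) y
        simpa only [Real.enorm_eq_ofReal_abs] using h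
    _ = ∫⁻ y, (‖y‖ₑ * ‖θ y‖ₑ) * ∫⁻ x, ‖fderiv ℝ (heatKernel (E := E) σ) x‖ₑ :=
        lintegral_congr fun y => by ring
    _ = (∫⁻ y, ‖y‖ₑ * ‖θ y‖ₑ) * ∫⁻ x, ‖fderiv ℝ (heatKernel (E := E) σ) x‖ₑ :=
        lintegral_mul_const _ (measurable_id.enorm.mul (hθc.enorm).measurable)


/-- **Caloric `L¹` decay of mean-zero data**: `∫ ‖e^{σΔ}θ‖ ≤ K σ^{-1/2}` for all `σ > 0`, for
`θ` continuous, compactly supported with `∫ θ = 0` (`K = 2^{n/2} ∫ ‖y‖ ‖θ(y)‖ dy`, from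
`lintegral_enorm_heatExtension_le_of_integral_eq_zero` and the `L¹` gradient bound of the heat
kernel `lintegral_enorm_fderiv_heatKernel_le`). [folklore] -/
theorem exists_integral_norm_heatExtension_le_of_integral_eq_zero [CompleteSpace F] {θ : E → F}
    (hθc : Continuous θ) (hθs : HasCompactSupport θ) (hθ0 : ∫ y, θ y = 0) :
    ∃ K : ℝ, ∀ σ : ℝ, 0 < σ → ∫ x, ‖heatExtension θ σ x‖ ≤ K * σ ^ (-(1 / 2 : ℝ)) := by
  -- the first absolute moment of `θ` is finite
  have hmom : Integrable (fun y => ‖y‖ * ‖θ y‖) volume :=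
    (continuous_norm.mul hθc.norm).integrable_of_hasCompactSupport hθs.norm.mul_left
  set Mθ : ℝ≥0∞ := ∫⁻ y, ‖y‖ₑ * ‖θ y‖ₑ with hMθ
  have hMθ_lt : Mθ < ⊤ := by
    have h := hmom.2
    rw [hasFiniteIntegral_iff_enorm] at h
    refine lt_of_le_of_lt (lintegral_mono fun y => ?_) h
    rw [Real.enorm_eq_ofReal_abs, abs_of_nonneg (by positivity), ENNReal.ofReal_mul (norm_nonneg _),
      ofReal_norm, ofReal_norm]
  refine ⟨Mθ.toReal * (2 : ℝ) ^ ((Module.finrank ℝ E : ℝ) / 2), fun σ hσ => ?_⟩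
  have hθi : Integrable θ volume := hθc.integrable_of_hasCompactSupport hθs
  have hint : Integrable (heatExtension θ σ) volume := integrable_heatExtension hθi hσ
  have hc0 : 0 ≤ (2 : ℝ) ^ ((Module.finrank ℝ E : ℝ) / 2) * σ ^ (-(1 / 2 : ℝ)) := by positivity
  rw [integral_norm_eq_lintegral_enorm hint.aestronglyMeasurable]
  have h1 := lintegral_enorm_heatExtension_le_of_integral_eq_zero hθc hθs hθ0 σ
  have h2 := lintegral_enorm_fderiv_heatKernel_le (E := E) hσ
  calc (∫⁻ x, ‖heatExtension θ σ x‖ₑ).toReal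
      ≤ (Mθ * ENNReal.ofReal ((2 : ℝ) ^ ((Module.finrank ℝ E : ℝ) / 2) * σ ^ (-(1 / 2 : ℝ)))).toReal := by
        refine ENNReal.toReal_mono (ENNReal.mul_ne_top hMθ_lt.ne ENNReal.ofReal_ne_top) ?_
        exact h1.trans (by gcongr)
    _ = Mθ.toReal * (2 : ℝ) ^ ((Module.finrank ℝ E : ℝ) / 2) * σ ^ (-(1 / 2 : ℝ)) := by
        rw [ENNReal.toReal_mul, ENNReal.toReal_ofReal hc0, mul_assoc]

end Caloric

/-! ### Weak-* continuity modulo constants -/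

section WeakStar

variable {u : ℝ → E → E} {M : ℝ}

/-- **Pairings with mean-zero test fields are continuous in time.** Let `u(t)`, `t < 0`, be
bounded by `M`, with measurable, weakly divergence-free slices, and with `t ↦ ∫⟪u(t), φ⟫`
continuous on `(-∞, 0)` for every divergence-free test field `φ` (as for bounded ancient mild
solutions in duality form, `IsBoundedAncientMildSolution.continuousOn_integral_inner`). Then
`t ↦ ∫⟪u(t), θ⟫` is continuous on `(-∞, 0)` for every test field `θ` with `∫ θ = 0`: `θ` has
caloric decay (`exists_integral_norm_heatExtension_le_of_integral_eq_zero`), hence is `-ΔW` up to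
an `L¹`-small error for some test field `W` (`exists_test_integral_norm_laplacian_add_le`), and
`∫⟪u(t), ΔW⟫` is continuous in `t` (`continuousOn_integral_inner_laplacian_of_divFree`); a uniform
limit of continuous functions is continuous. The mean is exactly what the spatially constant
ambiguity `b(t)` of KNSS 2009, §1, can see. [folklore] -/
theorem continuousOn_integral_inner_of_integral_eq_zero
    (hM : ∀ t < 0, ∀ x, ‖u t x‖ ≤ M) (hmeas : ∀ t < 0, AEStronglyMeasurable (u t) volume)
    (hdiv : ∀ t < 0, IsWeaklyDivFree (u t))
    (hcont : ∀ φ : E → E, FunctionSpaces.IsTestFunctionOn (⊤ : Opens E) φ → VectorCalculus.IsDivFree φ →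
      ContinuousOn (fun t => ∫ x, ⟪u t x, φ x⟫) (Iio 0))
    {θ : E → E} (hθ : FunctionSpaces.IsTestFunctionOn (⊤ : Opens E) θ) (hθ0 : ∫ x, θ x = 0) :
    ContinuousOn (fun t => ∫ x, ⟪u t x, θ x⟫) (Iio 0) := by
  have hdecay : ∃ K : ℝ, ∀ σ : ℝ, 1 ≤ σ →
      ∫ x, ‖heatExtension θ σ x‖ ≤ K * σ ^ (-(1 / 2 : ℝ)) := by
    obtain ⟨K, hK⟩ := exists_integral_norm_heatExtension_le_of_integral_eq_zero
      hθ.contDiff.continuous hθ.hasCompactSupport hθ0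
    exact ⟨K, fun σ hσ => hK σ (one_pos.trans_le hσ)⟩
  have hM0 : 0 ≤ M := (norm_nonneg _).trans (hM (-1) (by norm_num) 0)
  refine continuousOn_of_uniform_approx_of_continuousOn fun U hU => ?_
  obtain ⟨ε, hε, hεU⟩ := Metric.mem_uniformity_dist.1 hU
  have hε' : 0 < ε / (M + 1) := by positivity
  obtain ⟨W, hW, hWε⟩ := exists_test_integral_norm_laplacian_add_le hθ hdecay hε'
  refine ⟨fun t => -∫ x, ⟪u t x, Δ W x⟫,
    (continuousOn_integral_inner_laplacian_of_divFree hM hmeas hdiv hcont hW).neg, fun t ht => hεU ?_⟩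
  have hWl := hW.laplacian_top
  have i1 : Integrable (fun x => ⟪u t x, θ x⟫) volume :=
    integrable_inner_of_aestronglyMeasurable_of_norm_le (hmeas t ht) (hM t ht)
      (hθ.contDiff.continuous.integrable_of_hasCompactSupport hθ.hasCompactSupport)
  have i2 : Integrable (fun x => ⟪u t x, Δ W x⟫) volume :=
    integrable_inner_of_aestronglyMeasurable_of_norm_le (hmeas t ht) (hM t ht)
      (hWl.contDiff.continuous.integrable_of_hasCompactSupport hWl.hasCompactSupport)
  have i3 : Integrable (fun x => ‖Δ W x + θ x‖) volume :=
    ((hWl.contDiff.continuous.add hθ.contDiff.continuous).integrable_of_hasCompactSupport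
      (hWl.hasCompactSupport.add hθ.hasCompactSupport)).norm
  rw [Real.dist_eq, sub_neg_eq_add, ← integral_add i1 i2]
  have heq : (fun x => ⟪u t x, θ x⟫ + ⟪u t x, Δ W x⟫) = fun x => ⟪u t x, Δ W x + θ x⟫ := by
    funext x
    rw [← inner_add_right, add_comm]
  rw [heq]
  calc |∫ x, ⟪u t x, Δ W x + θ x⟫|
      ≤ ∫ x, ‖⟪u t x, Δ W x + θ x⟫‖ := by
        rw [← Real.norm_eq_abs]
        exact norm_integral_le_integral_norm _
    _ ≤ ∫ x, M * ‖Δ W x + θ x‖ := by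
        refine integral_mono_of_nonneg (Eventually.of_forall fun _ => norm_nonneg _)
          (i3.const_mul M) (Eventually.of_forall fun x => ?_)
        exact (norm_inner_le_norm _ _).trans (mul_le_mul_of_nonneg_right (hM t ht x) (norm_nonneg _))
    _ = M * ∫ x, ‖Δ W x + θ x‖ := integral_const_mul _ _
    _ ≤ M * (ε / (M + 1)) := mul_le_mul_of_nonneg_left hWε hM0
    _ < ε := by
        rw [mul_div_assoc', div_lt_iff₀ (by positivity)]
        nlinarith

/-- The average `m = ∫ ρ u` of a bounded measurable field against an integrable weight is bounded
by `M ∫ |ρ|`. [folklore] -/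
theorem norm_integral_smul_le {w : E → E} (hMw : ∀ x, ‖w x‖ ≤ M)
    {ρ : E → ℝ} (hρ : Integrable ρ volume) :
    ‖∫ y, ρ y • w y‖ ≤ M * ∫ y, |ρ y| := by
  have hM0 : 0 ≤ M := (norm_nonneg _).trans (hMw 0)
  calc ‖∫ y, ρ y • w y‖ ≤ ∫ y, ‖ρ y • w y‖ := norm_integral_le_integral_norm _
    _ ≤ ∫ y, M * |ρ y| := by
        refine integral_mono_of_nonneg (Eventually.of_forall fun _ => norm_nonneg _)
          (hρ.abs.const_mul M) (Eventually.of_forall fun y => ?_)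
        show ‖ρ y • w y‖ ≤ M * |ρ y|
        rw [norm_smul, Real.norm_eq_abs, mul_comm]
        exact mul_le_mul_of_nonneg_right (hMw y) (abs_nonneg _)
    _ = M * ∫ y, |ρ y| := integral_const_mul _ _

/-- **The normalised family is weak-* continuous in time.** Under the hypotheses of
`continuousOn_integral_inner_of_integral_eq_zero`, for a test function `ρ` of mass one and the
averages `m(t) = ∫ ρ u(t)`, the pairing `t ↦ ∫⟪u(t) − m(t), θ⟫` is continuous on `(-∞, 0)` for
EVERY test field `θ`: it equals `∫⟪u(t), θ − (∫θ) ρ⟫`, a pairing with a mean-zero test field.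
(Subtracting `m(t)` is the tree's rendering of fixing the spatially constant gauge `b(t)` of
KNSS 2009, §1 p. 3.) [folklore] -/
theorem continuousOn_integral_inner_sub_average
    (hM : ∀ t < 0, ∀ x, ‖u t x‖ ≤ M) (hmeas : ∀ t < 0, AEStronglyMeasurable (u t) volume)
    (hdiv : ∀ t < 0, IsWeaklyDivFree (u t))
    (hcont : ∀ φ : E → E, FunctionSpaces.IsTestFunctionOn (⊤ : Opens E) φ → VectorCalculus.IsDivFree φ →
      ContinuousOn (fun t => ∫ x, ⟪u t x, φ x⟫) (Iio 0))
    {ρ : E → ℝ} (hρ : FunctionSpaces.IsTestFunctionOn (⊤ : Opens E) ρ) (hρ1 : ∫ y, ρ y = 1)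
    {θ : E → E} (hθ : FunctionSpaces.IsTestFunctionOn (⊤ : Opens E) θ) :
    ContinuousOn (fun t => ∫ x, ⟪u t x - ∫ y, ρ y • u t y, θ x⟫) (Iio 0) := by
  set c : E := ∫ x, θ x with hc
  -- the mean-zero test field `θ₀ = θ − ρ • c`
  set θ₀ : E → E := fun x => θ x - ρ x • c with hθ₀
  have hθ₀t : FunctionSpaces.IsTestFunctionOn (⊤ : Opens E) θ₀ :=
    ⟨hθ.contDiff.sub (hρ.contDiff.smul contDiff_const),
      hθ.hasCompactSupport.sub hρ.hasCompactSupport.smul_right,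
      fun x _ => trivial⟩
  have hθi : Integrable θ volume :=
    hθ.contDiff.continuous.integrable_of_hasCompactSupport hθ.hasCompactSupport
  have hρi : Integrable ρ volume :=
    hρ.contDiff.continuous.integrable_of_hasCompactSupport hρ.hasCompactSupport
  have hθ₀0 : ∫ x, θ₀ x = 0 := by
    simp only [hθ₀]
    rw [integral_sub hθi (hρi.smul_const c), integral_smul_const, hρ1, one_smul, hc, sub_self]
  have hkey := continuousOn_integral_inner_of_integral_eq_zero hM hmeas hdiv hcont hθ₀t hθ₀0
  refine hkey.congr fun t ht => ?_
  -- both sides equal `∫⟪u t, θ⟫ − ⟪m t, c⟫`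
  have hub : MemLp (u t) ∞ volume := memLp_top_of_bound (hmeas t ht) M (Eventually.of_forall (hM t ht))
  have i1 : Integrable (fun x => ⟪u t x, θ x⟫) volume :=
    integrable_inner_of_aestronglyMeasurable_of_norm_le (hmeas t ht) (hM t ht) hθi
  have i2 : Integrable (fun x => ⟪u t x, ρ x • c⟫) volume :=
    integrable_inner_of_aestronglyMeasurable_of_norm_le (hmeas t ht) (hM t ht) (hρi.smul_const c)
  have i3 : Integrable (fun y => ρ y • u t y) volume := Integrable.smul_of_top_left hρi hub
  have i4 : Integrable (fun x => ⟪(∫ y, ρ y • u t y), θ x⟫) volume := hθi.const_inner _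
  have hL : (∫ x, ⟪u t x - ∫ y, ρ y • u t y, θ x⟫) =
      (∫ x, ⟪u t x, θ x⟫) - ⟪∫ y, ρ y • u t y, c⟫ := by
    calc (∫ x, ⟪u t x - ∫ y, ρ y • u t y, θ x⟫)
        = ∫ x, (⟪u t x, θ x⟫ - ⟪∫ y, ρ y • u t y, θ x⟫) :=
          integral_congr_ae (Eventually.of_forall fun x => by simp only [inner_sub_left])
      _ = (∫ x, ⟪u t x, θ x⟫) - ∫ x, ⟪∫ y, ρ y • u t y, θ x⟫ := integral_sub i1 i4
      _ = (∫ x, ⟪u t x, θ x⟫) - ⟪∫ y, ρ y • u t y, c⟫ := by rw [integral_inner hθi, ← hc]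
  have hR : (∫ x, ⟪u t x, θ₀ x⟫) = (∫ x, ⟪u t x, θ x⟫) - ⟪∫ y, ρ y • u t y, c⟫ := by
    calc (∫ x, ⟪u t x, θ₀ x⟫) = ∫ x, (⟪u t x, θ x⟫ - ⟪u t x, ρ x • c⟫) :=
          integral_congr_ae (Eventually.of_forall fun x => by simp only [hθ₀, inner_sub_right])
      _ = (∫ x, ⟪u t x, θ x⟫) - ∫ x, ⟪u t x, ρ x • c⟫ := integral_sub i1 i2
      _ = (∫ x, ⟪u t x, θ x⟫) - ⟪∫ y, ρ y • u t y, c⟫ := by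
          congr 1
          rw [real_inner_comm, ← integral_inner i3 c]
          refine integral_congr_ae (Eventually.of_forall fun y => ?_)
          show ⟪u t y, ρ y • c⟫ = ⟪c, ρ y • u t y⟫
          rw [real_inner_smul_right, real_inner_smul_right, real_inner_comm]
  show (∫ x, ⟪u t x - ∫ y, ρ y • u t y, θ x⟫) = ∫ x, ⟪u t x, θ₀ x⟫
  rw [hL, hR]

end WeakStar

/-! ### Jointly measurable modification modulo spatial constants -/

section Modification

variable {ν : ℝ} {u : ℝ → E → E}

/-- **A bounded ancient mild solution in duality form is jointly measurable modulo spatial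
constants.** Let `u` be a bounded ancient mild solution (`0 < ν`, duality form) with
a.e.-strongly measurable slices, and `ρ` a test function of mass one. Then there is a jointly
strongly measurable `w : ℝ → E → E` with `w(t) = u(t) − m(t)` a.e. for EVERY `t < 0`, where
`m(t) = ∫ ρ u(t)` are the averages of the slices: the normalised family `u(t) − m(t)` is bounded,
has measurable slices and is weak-* continuous in time (`continuousOn_integral_inner_sub_average`,
the pairings with divergence-free tests being continuous by
`IsBoundedAncientMildSolution.continuousOn_integral_inner`), so
`exists_stronglyMeasurable_modification` applies. This isolates the parasitic drift of KNSS 2009,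
§1 p. 3 ("the notion of weak solution does allow the parasitic solutions `u(x,t) = b(t)`") as the
ONLY obstruction to joint measurability in the slice-wise duality-form class. [folklore] -/
theorem IsBoundedAncientMildSolution.exists_stronglyMeasurable_modification_sub_average
    (hu : IsBoundedAncientMildSolution ν u) (hν : 0 < ν)
    (hmeas : ∀ t < 0, AEStronglyMeasurable (u t) volume)
    {ρ : E → ℝ} (hρ : FunctionSpaces.IsTestFunctionOn (⊤ : Opens E) ρ) (hρ1 : ∫ y, ρ y = 1) :
    ∃ w : ℝ → E → E, StronglyMeasurable (uncurry w) ∧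
      ∀ t < 0, w t =ᵐ[volume] fun x => u t x - ∫ y, ρ y • u t y := by
  obtain ⟨M, hM'⟩ := hu.2
  have hM : ∀ t < 0, ∀ x, ‖u t x‖ ≤ M := fun t ht x => hM' t ht x
  have hρi : Integrable ρ volume :=
    hρ.contDiff.continuous.integrable_of_hasCompactSupport hρ.hasCompactSupport
  set U : ℝ → E → E := fun t x => u t x - ∫ y, ρ y • u t y with hU
  have hUM : ∀ t < 0, ∀ x, ‖U t x‖ ≤ M + M * ∫ y, |ρ y| := fun t ht x =>
    (norm_sub_le _ _).trans (add_le_add (hM t ht x) (norm_integral_smul_le (hM t ht) hρi))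
  have hUmeas : ∀ t < 0, AEStronglyMeasurable (U t) volume := fun t ht =>
    (hmeas t ht).sub aestronglyMeasurable_const
  have hws : ∀ θ : E → E, FunctionSpaces.IsTestFunctionOn (⊤ : Opens E) θ →
      ContinuousOn (fun t => ∫ x, ⟪U t x, θ x⟫) (Iio 0) := fun θ hθ =>
    continuousOn_integral_inner_sub_average hM hmeas hu.1.1
      (fun φ hφ hdiv => hu.continuousOn_integral_inner hν hmeas hφ hdiv) hρ hρ1 hθ
  obtain ⟨w, hw, hwU⟩ := exists_stronglyMeasurable_modification hUM hUmeas hws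
  exact ⟨w, hw, hwU⟩

end Modification

end Literature.Analysis.FluidPDE
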